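/-
Copyright (c) 2026 the pub-hodgecm-mathlib formalisation cell (harness21).  Prover seat hodgecm-mathlib-LH4-p05 (g8), Track A «(D-RAM) FOUR-FRAME» squad, helper lane on
h413 = stmt-HodgeConjecture-24833 (count-neutral).  DEFS LEAF №6 «STAGE-1b DERIVED (T₊)» — heir dealer∕pen LH4-plan (g13) WORD #58 RULING B (i) «GO NOW: your (L-T+) v8 §0–§2
VERBATIM»; directive D-1b §4 (ED. 6, T₊ DERIVED); heir LEAD F0P3a-plan (g20) T19-31 (R-29)(b) ∕ T19-32 ∕ T19-35.  Single writer; text = (L-T+)-SIG v5 ∕ scratch v8 5bf8a2d172f1b186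
(boxes LH4-r01 LM∕LR, REF5 R5-269∕R5-274).  2026-09-04.
-/
import Summits.HodgeConjecture.HodgeConjecture.Theorems.F0P3cDyRamStageOneBDefs   -- ★ p859562 DEFS LEAF №5 «STAGE-1b» (F0P3a-p01 (g36)): `cleanMinusFixCount`, `mcOfRecord`, `sTOfRecord`, `n0CleanOfRecord`, `LevKappaSignLawAtS2`, …; brings ★ №1-R2 `OmegaSchedule`, ★ №1-R `shiftR`, ★ `omegaR`, ★ №1 `DyadicFence`, ★ census DEFS `transvPlusFixCount`, ★ #0a tokens
import HarnessLib

/-!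
# Crux `H413`, line LH4 «(D-RAM) FOUR-FRAME» — DEFS LEAF №6 «STAGE-1b DERIVED (T₊)»: the amplitude letters, the two LABELLED census Props (α′)∕(β), the T₊ κ-law Prop in the
# amplitude letter `A`, and its ∀-closure targets — the vocabulary in which tier-0 ED. 6 states the DERIVED split of `stub_rows_transvPlus` (one body per name; nothing asserted)

Cell `hodgecm-mathlib` (D-0151), FLOOR 0, crux item H413 = `stmt-HodgeConjecture-24833`, route `HCCMUnconditional`; squad F0∕P3c∕LH4.  DEF LANE (`--kind definition --supports
stmt-HodgeConjecture-24833 --as helper`): `def`s + `rfl`∕`decide`∕one-line ties only; no instance, no notation, no `sorry`, default heartbeats; ★ `Theorems` imports only.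

WHY (D-1b §4; heir LEAD T19-31 (R-29)(b) «T₊ DERIVED»; T19-32 «no primary (L-T+) letter»; F0P3-p01 (g35) TEMPLATE-LAWS 0e5ec958 §2–§3; LH4-r01 BOX LQ (27∕27) ∕ REF5 R5-274 (signs)).
Row `stub_rows_transvPlus : PieceRowsWild gselStar 1` is reached by ★ p859064 `pieceRowsWild_gselStar_one_of_fencedLaw_of_hside shift Ω N₀ A (hL) (hH)` (LH4-p14 (g6), j = 1 over
★ p858837), whose `hL` slot is the FENCED κ-signed census law of `f_{T+}` in an amplitude letter `A q d t k B`.  That law is NOT a primitive STAGE-1b statement: on a type-(1) four-frame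
literal the LABEL forces the CLEAN square level `m_c = mcOfRecord d` (★ №5), so the clean shell `shellFixCount (ℓ₀, m_c)` splits as `T+ ⊔ T−′` with `T+ = transvPlusFixCount (ℓ₀, m*)`,
`T−′ = cleanMinusFixCount (ℓ₀, m*, m_c)` (★ №5), and `T+ − T−′` is frame-constant; with `Σ_b κ_i(b) = 0` this gives `2·κ_i(T+) = κ_i(lev_{ℓ₀,m_c}) − κ_i(lev_{ℓ₀+1,m_c})`, i.e. the
T₊ law is HALF THE DIFFERENCE of two instances of ★ №5's `LevKappaSignLawAtS2` at square level `m_c` (exponents `(s, s)` and `(s+1, s−1)`, `s = sTOfRecord d`), GIVEN the two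
labelled statements (α′) and (β) below.  This leaf names: §1 the amplitude LETTERS (`amplShift`, `amplHalfDiff`, the DERIVED T₊ letter `amplTransvPlusDerived` = F0P3-p01's «A_T»
token for token — boxed 27∕27 wild keys, LH4-r01 LQ) and the threshold letter `n0DerivedOfRecord := max n0CleanOfRecord mcOfRecord` (deep enough for LH4-p13 (g8)'s (L-lab-14)
proof of (α′) at EVERY `d`, and ≥ `n0CleanOfRecord` so that (T4)(T5)(β) feed it by antitonicity); §2 the PROPS — (α′) `LabelPlusCleanLawAt N₀ mc` (= the body of LH4-p13's ★-to-be
`latticeInLevel_sq_of_shell_of_labelPlus_ofRecord`, binder for binder), (β) `CleanSgnFrameConstLawAt N₀ mc` (THE one labelled census statement of the T₊ road; F4-symmetry, 35∕35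
wild rows in ENGINE currency, F0P3-p01 REFIT f25b87ca), the T₊∕T₋ κ-law Props `TransvPlus∕MinusKappaSignLawAtS2 shift Ω N₀ A` (★ №1-R2 binder block VERBATIM, count token
`transvPlusFixCount σ ϖ d (d % 2) (mstarOfRecord d)`, amplitude a LETTER — LH4-p14 (g6)'s `hLaw` at one datum, 0 token edits per LH4-r01 BOX LM), and the ∀-closure targets
`TransvPlusLawTarget N₀ A` ∕ `TransvPlusLawTargetDerived N₀T`; §3 ties.  The sorry-free REDUCTION `TransvPlusLawTargetDerived N₀T ⟸ (T4) ∧ (T5) ∧ (α′) ∧ (β)` is the companion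
`Theorems/F0P3cDyRamTransvPlusLawOfCleanLevels.lean` (this seat, next).  EVERY PROP HERE IS A CENSUS LAW ∕ G-SIDE STATEMENT — a PROVER TARGET, never a literature fact; nothing asserted.
HONEST LABEL.  Count-neutral (`--supports`): a DEFS leaf pays no row; tier-0 rows T₊ (primitive in ED. 5) ∕ the six ED. 5 letters OPEN; `HC_CM` is proved only modulo the 7 printed
citations (2 remaining named inputs: hLiu418 = `stmt-HodgeConjecture-24832`, h413 = `stmt-HodgeConjecture-24833`) until rung 0 closes.

## References
* [Rogawski1990] J. D. Rogawski, *Automorphic Representations of Unitary Groups in Three Variables*, Ann. of Math. Stud. 123 (1990): §4.9 Prop. 4.9.1 (a)(b) p. 55, Lemma 4.9.3 p. 56.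
* [Kottwitz1986BaseChangeUnits] R. E. Kottwitz, *Base change for unit elements of Hecke algebras*, Compositio Math. 60 (1986), §1 pp. 240–241.
* [LanglandsShelstad1987] R. P. Langlands, D. Shelstad, *On the definition of transfer factors*, Math. Ann. 278 (1987), §1.3, §3.
-/

set_option autoImplicit false

noncomputable section

namespace Summit.HodgeConjecture.HodgeConjecture.Cruxes.H413.F0P3cDyRamStageOneBDerivedDefs

open scoped Matrix MatrixGroups ValuativeRel WithZero
open Literature.NumberTheory.Automorphic Literature.NumberTheory.Automorphic.HermitianLattice
  Literature.NumberTheory.Automorphic.UnitaryLatticeTree Literature.NumberTheory.Automorphic.UnitaryThreeFourFrame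
open Summit.HodgeConjecture.HodgeConjecture.Cruxes.H413.F0P3cDyRamFourFrameLawDefs
open Summit.HodgeConjecture.HodgeConjecture.Cruxes.H413.F0P3cDyRamFourFrameLawDefsR
open Summit.HodgeConjecture.HodgeConjecture.Cruxes.H413.F0P3cDyRamFourFrameLawDefsR2
open Summit.HodgeConjecture.HodgeConjecture.Cruxes.H413.F0P3cDyRamOmegaRDefs
open Summit.HodgeConjecture.HodgeConjecture.Cruxes.H413.F0P3cDyRamFourFramePieces
open Summit.HodgeConjecture.HodgeConjecture.Cruxes.H413.F0P3cDyRamFourFrameCensusDefs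
open Summit.HodgeConjecture.HodgeConjecture.Cruxes.H413.F0P3cDyRamStageOneBDefs

/-! ## §1  Amplitude letters (type `ℕ → ℕ → ℕ → ℕ → ℤ → ℚ`, arguments `(q, d, t_E, k, B)` = the junctions' `A` slot) and the ED. 6 threshold letter -/

/-- AMPLITUDE LETTER · `amplShift ks bs` — the UNIT's amplitude ★ `ampl` read at SHIFTED exponents `(k − ks d, B − bs d)` (letter type `A q d t k B : ℚ` = LH4-p14 (g6)'s
(V-T+) vehicle parameter; `t`-slot unused here).  Instances: ★ №5 `amplCs = amplShift csOfRecord csOfRecord`, `amplLevHi = amplShift klOfRecord blOfRecord` by `rfl` (§3). [cite: Rogawski1990, §4.9 Prop. 4.9.1 (a) p. 55] -/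
def amplShift (ks bs : ℕ → ℕ) : ℕ → ℕ → ℕ → ℕ → ℤ → ℚ := fun q d _t k B => ampl q (k - ks d) (B - bs d)

/-- AMPLITUDE LETTER · `amplHalfDiff A A' = (A − A') ∕ 2` — HALF THE SHELL AMPLITUDE when `A`, `A'` are the lower ∕ upper two-level letters (TEMPLATE-LAWS §2: `κ_i(T+) = ½·κ_i(clean shell)`). [cite: Rogawski1990, §4.9 Prop. 4.9.1 (a) p. 55] -/
def amplHalfDiff (A A' : ℕ → ℕ → ℕ → ℕ → ℤ → ℚ) : ℕ → ℕ → ℕ → ℕ → ℤ → ℚ := fun q d t k B => (A q d t k B - A' q d t k B) / 2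

/-- **THE DERIVED T₊ AMPLITUDE LETTER** `amplTransvPlusDerived q d t k B = ½·(ampl q (k − s) (B − s) − ampl q (k − (s+1)) (B − (s−1)))`, `s = sTOfRecord d` — F0P3-p01 (g35)
TEMPLATE-LAWS §2 «A_T» TOKEN FOR TOKEN (= `amplHalfDiff (amplShift s s) (amplShift (s+1) (s−1))`): DERIVED from ★ p859102's Levi exponents + the transvection grading + (α)(β), and it
FITS R-U 9∕9, R-P 16∕16 incl. (7,7,13) and (9,11,9) (his table `refit/REFIT-Tplus.v1`).  The letter of record of the DERIVED road (heir LEAD T19-32: «no primary (L-T+) letter»; magnitudes LH4-r01 BOX LQ 27∕27, signs = the two level laws' R2 token, REF5 R5-274); nothing asserted.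
[cite: Rogawski1990, §4.9 Prop. 4.9.1 (a) p. 55] -/
def amplTransvPlusDerived : ℕ → ℕ → ℕ → ℕ → ℤ → ℚ :=
  amplHalfDiff (amplShift sTOfRecord sTOfRecord) (amplShift (fun d => sTOfRecord d + 1) (fun d => sTOfRecord d - 1))

/-- The derived letter unfolds to the memo's closed form — `rfl`. [cite: Rogawski1990, §4.9 Prop. 4.9.1 (a) p. 55] -/
theorem amplTransvPlusDerived_apply (q d t k : ℕ) (B : ℤ) :
    amplTransvPlusDerived q d t k B =
      (ampl q (k - (d - 1 + d % 2)) (B - ((d - 1 + d % 2 : ℕ) : ℤ)) - ampl q (k - (d - 1 + d % 2 + 1)) (B - ((d - 1 + d % 2 - 1 : ℕ) : ℤ))) / 2 := rfl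


/-- `n0DerivedOfRecord d = max (n0CleanOfRecord d) (mcOfRecord d)` — THE NEAR-1 THRESHOLD OF THE DERIVED T₊ LAW: at least `n0CleanOfRecord` (★ №5; the threshold of (T4)(T5)(β):
4, 7 at d = 2, 3) so that those three feed the reduction by antitonicity, and at least `mcOfRecord d` so that LH4-p13 (g8)'s (L-lab-14) proof of (α′) — which needs exactly
`m_c ≤ N₀ + ℓ₀` — applies at EVERY `d` (with `n0CleanOfRecord` alone it applies iff `d ≤ 3`, p13 11:03:51Z (iv)).  Values 4, 8, 10, 14 at d = 2..5.  Rows only need a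
neighbourhood of `1`, so the deeper fence costs nothing downstream ((J) takes any `N₀`). [cite: Rogawski1990, §4.9 Prop. 4.9.1 (a) p. 55] -/
def n0DerivedOfRecord (d : ℕ) : ℕ := max (n0CleanOfRecord d) (mcOfRecord d)

/-! ## §2  The ED. 6 Props: (α′) label ⇒ clean, (β) clean sign census frame-constant, the T₊∕T₋ κ-laws in the amplitude letter `A` (★ №1-R2 binder block VERBATIM), the ∀-closure targets -/

/-- (α′)-At · **`LabelPlusCleanLawAt N₀ mc`** — THE LABEL FORCES THE CLEAN SQUARE LEVEL: on every type-(1) four-frame literal at an element datum of depth `≥ N₀ d`, every fixed type-0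
vertex on the shell of record `(ℓ₀, m*)` carrying `LabelPlus` (precision `m*`) has `X²·M ⊆ ϖ^{mc d}M` (F0P3-p01 (g35) TEMPLATE-LAWS §2 set identity «shell ∧ (LabelPlus ∨ LabelMinus′) =
shell ∧ X² ∈ ϖ^{m_c}», its `LabelPlus` half; vertex data d = 3 keys (7,7,9) (7,7,11) (9,7,7) (7,7,13) + N ∩ K all d; mechanism = the trace identity — LH4-p13 (g8) (L-lab-6) lane).
★ №1 `StableLawAt` binder block to `Γ`.  = the BODY of LH4-p13 (g8)'s (L-lab-14) HEAD `latticeInLevel_sq_of_shell_of_labelPlus_ofRecord` binder for binder at `mc := mcOfRecord`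
(he PROVES it under the fence `mc d ≤ N₀ d + d % 2` — hence at `N₀ := n0DerivedOfRecord` for every `d`, at `n0CleanOfRecord` for `d ≤ 3`).  A PROVER TARGET (near-1, population-
shaped — NOT a pointwise K-wide identity, F0P3-p01 10:26Z erratum), nothing asserted. [cite: Rogawski1990, §4.9 Prop. 4.9.1 (b) p. 55] [cite: Kottwitz1986BaseChangeUnits, §1 pp. 240–241] -/
def LabelPlusCleanLawAt {K : Type} [Field K] [Valued K ℤᵐ⁰] [CompleteSpace K] [Fintype (Valued.ResidueField K)] (N₀ mc : ℕ → ℕ) (σ : K →+* K) (ϖ : K) (d t : ℕ) : Prop :=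
    IsRamifiedQuadraticDatum σ ϖ d t →
    ∀ (f : Fin 4 → Fin 3 → (Fin 3 → K)), IsFourFrameFamily σ f →
    ∀ (α β : K) (n₁ n₂ n₃ : ℕ), IsElementDatum σ ϖ (N₀ d) α β n₁ n₂ n₃ →
    ∀ (Γ : Fin 4 → GL (Fin 3) K), (∀ b, (Γ b : Matrix (Fin 3) (Fin 3) K) = frameElt σ f b α β) →
      ∀ (b : Fin 4) (M : Submodule (Valued.integer K) (Fin 3 → K)),
        IsVertexLattice σ ϖ ((StdForm.antidiagonal 3).over K) 0 M → mapGL (Γ b) M = M →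
        LatticeNearTransvShell ϖ (d % 2) (mstarOfRecord d) ((Γ b : Matrix (Fin 3) (Fin 3) K) - 1) M →
        LatticeLabelPlus σ ϖ d (mstarOfRecord d) M ((Γ b : Matrix (Fin 3) (Fin 3) K) - 1) →
          LatticeInLevel ϖ (mc d) (((Γ b : Matrix (Fin 3) (Fin 3) K) - 1) * ((Γ b : Matrix (Fin 3) (Fin 3) K) - 1)) M

/-- (β)-At · **`CleanSgnFrameConstLawAt N₀ mc`** — THE CLEAN SIGN CENSUS IS FRAME-CONSTANT: on every type-(1) four-frame family at depth `≥ N₀ d`, the difference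
`transvPlusFixCount (ℓ₀, m*) − cleanMinusFixCount (ℓ₀, m*, mc d)` (`T+ − T−′`) takes the same value on the four frames — equivalently `κ_i(T+) = κ_i(T−′)` for the three `i`
(F0P3-p01 TEMPLATE-LAWS §3 (β) «F4-symmetry», empirical 30+ keys every cell; THE ONE genuinely labelled statement left on row (1); mechanism: LH4-p08 (O2) ∕ LH4-p09 labelled strata —
norm-class equidistribution per stratum).  ★ №1 `StableLawAt` block to `Γ`.  Instance of record `CleanSgnFrameConstLawAt n0CleanOfRecord mcOfRecord`.  CENSUS LAW — a FIT (F0P3-p01 REFIT f25b87ca: `κ(T+) = κ(T−′)` on 35∕35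
wild rows) typed as a PROVER TARGET, nothing asserted. [cite: Rogawski1990, §4.9 Prop. 4.9.1 (a)(b) p. 55] [cite: LanglandsShelstad1987, §1.3] -/
def CleanSgnFrameConstLawAt {K : Type} [Field K] [Valued K ℤᵐ⁰] [CompleteSpace K] [Fintype (Valued.ResidueField K)] (N₀ mc : ℕ → ℕ) (σ : K →+* K) (ϖ : K) (d t : ℕ) : Prop :=
    IsRamifiedQuadraticDatum σ ϖ d t →
    ∀ (f : Fin 4 → Fin 3 → (Fin 3 → K)), IsFourFrameFamily σ f →
    ∀ (α β : K) (n₁ n₂ n₃ : ℕ), IsElementDatum σ ϖ (N₀ d) α β n₁ n₂ n₃ →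
    ∀ (Γ : Fin 4 → GL (Fin 3) K), (∀ b, (Γ b : Matrix (Fin 3) (Fin 3) K) = frameElt σ f b α β) →
      ∃ c : ℤ, ∀ b : Fin 4,
        (transvPlusFixCount σ ϖ d (d % 2) (mstarOfRecord d) (Γ b) : ℤ) - (cleanMinusFixCount σ ϖ d (d % 2) (mstarOfRecord d) (mc d) (Γ b) : ℤ) = c

/-- (K-SGN-T+)-S2-At · **THE κ-SIGNED FOUR-FRAME CENSUS LAW OF THE PIECE `f_{T+}`** at one datum — the (L-T+) cell: ★ №1-R2 `KappaSignLawAtS2`'s binder block VERBATIM with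
`fixedVertexCount σ ϖ 0 (Γ b') ↦ transvPlusFixCount σ ϖ d (d % 2) (mstarOfRecord d) (Γ b')` (★ census DEFS :97; at a place this IS `cntStar 1` after `dOfPlace = d`, §4) and
`ampl q k B ↦ A q d t k B` (amplitude LETTER — a PARAMETER until the re-fit of record, T19-30 (2)), SAME sign token `Ω·baseSign·normSign(fPartProd)` — THIS BODY IS LH4-p14 (g6)'s (V-T+) `hLaw` AT ONE
DATUM, TOKEN FOR TOKEN (`SigHTplus.scratch.v2` a9715496 :168).  DERIVED (companion brick `F0P3cDyRamTransvPlusLawOfCleanLevels`) from ★ №5's two `LevKappaSignLawAtS2` instances at square level `mc` + (α′) + (β), with `A := amplHalfDiff (amplShift k₁ b₁) (amplShift k₂ b₂)`; a FIT typed as a PROVER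
TARGET, nothing asserted. [cite: Rogawski1990, §4.9 Prop. 4.9.1 (a) p. 55] [cite: LanglandsShelstad1987, §1.3] -/
def TransvPlusKappaSignLawAtS2 {K : Type} [Field K] [Valued K ℤᵐ⁰] [CompleteSpace K] [Fintype (Valued.ResidueField K)] (shift : ℕ → ℕ → ℤ) (Ω : OmegaSchedule) (N₀ : ℕ → ℕ)
    (A : ℕ → ℕ → ℕ → ℕ → ℤ → ℚ) (σ : K →+* K) (ϖ : K) (d t : ℕ) : Prop :=
    IsRamifiedQuadraticDatum σ ϖ d t →
    ∀ (f : Fin 4 → Fin 3 → (Fin 3 → K)), IsFourFrameFamily σ f →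
    ∀ (δ : K), σ δ = -δ → δ ≠ 0 →
    ∀ (a b : K), a * σ a = 1 → b * σ b = 1 → Valued.v (a - 1) < Valued.v (2 : K) → Valued.v (b - 1) < Valued.v (2 : K) →
    ∀ (n₁ n₂ n₃ : ℕ), IsElementDatum σ ϖ (N₀ d) (a * a) (b * b) n₁ n₂ n₃ →
    ∀ (Γ : Fin 4 → GL (Fin 3) K), (∀ b', (Γ b' : Matrix (Fin 3) (Fin 3) K) = frameElt σ f b' (a * a) (b * b)) →
    ∀ (k : ℕ), 2 * k + d = n₁ + n₂ + n₃ + 2 →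
    ∀ (i : Fin 3) (B : ℤ), 2 * B = ((![n₁, n₂, n₃] : Fin 3 → ℕ) i : ℤ) - d + 2 - 2 * shift d t →
      ((∑ b' : Fin 4, kappaChar i b' * (transvPlusFixCount σ ϖ d (d % 2) (mstarOfRecord d) (Γ b') : ℤ) : ℤ) : ℚ) =
          (Ω K σ ϖ d a b i * (baseSign σ i * normSign σ (fPartProd δ ![a, b, 1] i)) : ℤ) * A (Fintype.card (Valued.ResidueField K)) d t k B

/-- (K-SGN-T−)-S2-At · the same law for `f_{T−}` — SAME right-hand side (F4: the label is κ-invisible on type (1)); serves the row `transvMinus` if the directive goes direct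
rather than through ★ p858649 `pieceRowsWild_gselStar_two_of` (it does NOT: T₋ is DERIVED, heir LEAD T19-30 (2)); kept as vocabulary, nothing asserted. [cite: Rogawski1990, §4.9 Prop. 4.9.1 (a) p. 55] -/
def TransvMinusKappaSignLawAtS2 {K : Type} [Field K] [Valued K ℤᵐ⁰] [CompleteSpace K] [Fintype (Valued.ResidueField K)] (shift : ℕ → ℕ → ℤ) (Ω : OmegaSchedule) (N₀ : ℕ → ℕ)
    (A : ℕ → ℕ → ℕ → ℕ → ℤ → ℚ) (σ : K →+* K) (ϖ : K) (d t : ℕ) : Prop :=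
    IsRamifiedQuadraticDatum σ ϖ d t →
    ∀ (f : Fin 4 → Fin 3 → (Fin 3 → K)), IsFourFrameFamily σ f →
    ∀ (δ : K), σ δ = -δ → δ ≠ 0 →
    ∀ (a b : K), a * σ a = 1 → b * σ b = 1 → Valued.v (a - 1) < Valued.v (2 : K) → Valued.v (b - 1) < Valued.v (2 : K) →
    ∀ (n₁ n₂ n₃ : ℕ), IsElementDatum σ ϖ (N₀ d) (a * a) (b * b) n₁ n₂ n₃ →
    ∀ (Γ : Fin 4 → GL (Fin 3) K), (∀ b', (Γ b' : Matrix (Fin 3) (Fin 3) K) = frameElt σ f b' (a * a) (b * b)) →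
    ∀ (k : ℕ), 2 * k + d = n₁ + n₂ + n₃ + 2 →
    ∀ (i : Fin 3) (B : ℤ), 2 * B = ((![n₁, n₂, n₃] : Fin 3 → ℕ) i : ℤ) - d + 2 - 2 * shift d t →
      ((∑ b' : Fin 4, kappaChar i b' * (transvMinusFixCount σ ϖ d (d % 2) (mstarOfRecord d) (Γ b') : ℤ) : ℤ) : ℚ) =
          (Ω K σ ϖ d a b i * (baseSign σ i * normSign σ (fPartProd δ ![a, b, 1] i)) : ℤ) * A (Fintype.card (Valued.ResidueField K)) d t k B

/-- **(T) THE (L-T+) TARGET, TEMPLATE FORM**: `TransvPlusLawTarget N₀ A` = «at every complete datum with finite residue field, behind the dyadic fence, the κ-signed `f_{T+}` census law at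
the schedules of record `(shiftR, omegaR)` with threshold `N₀` and amplitude letter `A`».  The STAGE-1b (L-T+) producer proves `TransvPlusLawTarget N₀T A_T` for the lettered
`(N₀T, A_T)` of the re-fit of record (T19-30 (2)(a) predict from the Levi law `ρ_{T+}`, (b) read κ_i(`pieceTransvPlus`) at ≥ 8 keys ∕ ≥ 3 cells, (c) box the digits); ★ p859064's junction (j = 1)
consumes exactly this hypothesis (`hL`).  Letter of record on the derived road: `amplTransvPlusDerived` (§1).  Nothing asserted. [cite: Rogawski1990, §4.9 Prop. 4.9.1 (a) p. 55] -/
def TransvPlusLawTarget (N₀ : ℕ → ℕ) (A : ℕ → ℕ → ℕ → ℕ → ℤ → ℚ) : Prop :=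
  ∀ {K : Type} [Field K] [Valued K ℤᵐ⁰] [CompleteSpace K] [Fintype (Valued.ResidueField K)] (σ : K →+* K) (ϖ : K) (d t : ℕ),
    DyadicFence (K := K) (TransvPlusKappaSignLawAtS2 shiftR omegaR N₀ A σ ϖ d t)

/-- The template IS the ∀-closure ★ p859064's junction eats at `(shift, Ω) := (shiftR, omegaR)` — `Iff.rfl`. [cite: Rogawski1990, §4.9 Prop. 4.9.1 (a) p. 55] -/
theorem transvPlusLawTarget_iff (N₀ : ℕ → ℕ) (A : ℕ → ℕ → ℕ → ℕ → ℤ → ℚ) :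
    TransvPlusLawTarget N₀ A ↔
      ∀ {K : Type} [Field K] [Valued K ℤᵐ⁰] [CompleteSpace K] [Fintype (Valued.ResidueField K)] (σ : K →+* K) (ϖ : K) (d t : ℕ),
        DyadicFence (K := K) (TransvPlusKappaSignLawAtS2 shiftR omegaR N₀ A σ ϖ d t) :=
  Iff.rfl

/-- **(T∘) THE (L-T+) TARGET AT THE DERIVED LETTER** — `TransvPlusLawTarget N₀T amplTransvPlusDerived` (instance of record: `N₀T := n0CleanOfRecord`, F0P3a-p01 (L-lev) v4∕scratch v6); by the companion brick it FOLLOWS from F0P3a-p01's (L-lev) law at the clean square level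
`(laLowOfRecord, mcOfRecord, sT, sT)` and `(laHighOfRecord, mcOfRecord, sT+1, sT−1)` + (α) + (β) (thresholds weakened to the common `N₀T`).  Instance of record: `N₀T := n0DerivedOfRecord`
(every `d`; = `n0CleanOfRecord`'s reading on d ≤ 3 up to the deeper fence at d = 3: 8 vs 7).  Nothing asserted. [cite: Rogawski1990, §4.9 Prop. 4.9.1 (a) p. 55] -/
def TransvPlusLawTargetDerived (N₀T : ℕ → ℕ) : Prop := TransvPlusLawTarget N₀T amplTransvPlusDerived


/-! ## §3  Ties (`rfl` ∕ `decide` ∕ one-liners) -/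

/-- ★ №5's `amplCs` IS `amplShift csOfRecord csOfRecord` — `rfl`. [cite: Rogawski1990, §4.9 Prop. 4.9.1 (a) p. 55] -/
theorem amplCs_eq_amplShift : amplCs = amplShift csOfRecord csOfRecord := rfl

/-- ★ №5's `amplLevHi` IS `amplShift klOfRecord blOfRecord` — `rfl`. [cite: Rogawski1990, §4.9 Prop. 4.9.1 (a) p. 55] -/
theorem amplLevHi_eq_amplShift : amplLevHi = amplShift klOfRecord blOfRecord := rfl

/-- `n0CleanOfRecord d ≤ n0DerivedOfRecord d`. [cite: Rogawski1990, §4.9 Prop. 4.9.1 (a) p. 55] -/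
theorem n0CleanOfRecord_le_n0DerivedOfRecord (d : ℕ) : n0CleanOfRecord d ≤ n0DerivedOfRecord d := le_max_left _ _

/-- `mcOfRecord d ≤ n0DerivedOfRecord d` — so (L-lab-14)'s fence `mc d ≤ N₀ d + d % 2` holds at `N₀ := n0DerivedOfRecord` for every `d`. [cite: Rogawski1990, §4.9 Prop. 4.9.1 (a) p. 55] -/
theorem mcOfRecord_le_n0DerivedOfRecord (d : ℕ) : mcOfRecord d ≤ n0DerivedOfRecord d := le_max_right _ _

/-- The (L-lab-14) fence at the derived threshold: `mcOfRecord d ≤ n0DerivedOfRecord d + d % 2` for every `d`. [cite: Rogawski1990, §4.9 Prop. 4.9.1 (a) p. 55] -/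
theorem mcOfRecord_le_n0DerivedOfRecord_add (d : ℕ) : mcOfRecord d ≤ n0DerivedOfRecord d + d % 2 :=
  (mcOfRecord_le_n0DerivedOfRecord d).trans (Nat.le_add_right _ _)

/-- The small values: `sT(1..5) = (1, 1, 3, 3, 5)`, `n0Derived(1..5) = (3, 4, 8, 10, 14)`. [cite: Rogawski1990, §4.9 Prop. 4.9.1 (a) p. 55] -/
theorem derivedLetters_small :
    (sTOfRecord 1, sTOfRecord 2, sTOfRecord 3, sTOfRecord 4, sTOfRecord 5) = (1, 1, 3, 3, 5) ∧
      (n0DerivedOfRecord 1, n0DerivedOfRecord 2, n0DerivedOfRecord 3, n0DerivedOfRecord 4, n0DerivedOfRecord 5) = (3, 4, 8, 10, 14) := by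
  decide

end Summit.HodgeConjecture.HodgeConjecture.Cruxes.H413.F0P3cDyRamStageOneBDerivedDefs

end
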